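import Mathlib
import Summits.Schanuel.Schanuel.Theses.RigidCore
import Summits.Schanuel.Schanuel.Theorems.AclSubsetLogFreeCore.Negative.LogFreeCoreCountable
import Summits.Schanuel.Schanuel.Theorems.RigidCoreSchanuelOnLogFreeCoreRelLWZeroOfCrux
import Summits.Schanuel.Schanuel.Theorems.RigidCoreSchanuelOnLogFreeCoreRelLWStepOfCrux
import Summits.Schanuel.Schanuel.Theorems.RigidCoreSchanuelOnLogFreeCoreRelLWZeroOfStageZero
import Summits.Schanuel.Schanuel.Theorems.RigidCoreSchanuelOnLogFreeCoreTowerReduction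
import Summits.Schanuel.Schanuel.Theorems.RigidCoreSchanuelOnLogFreeCoreRelLWStepOfStageSucc

/-!
# The kernel-tower normal forms of `RigidCore.SchanuelOnLogFreeCore` are EXACT

Support file for crux stmt-Schanuel-0970 (route RigidCore, line `kernel-tower-relative-lw`, lead
seat c3).  It assembles, BY NAME over the landed one-directional theorems of seat c2, the three
equivalences that the line's skeleton (`Cruxes/SchanuelOnLogFreeCore/Lines/kernel_tower_relative_lw.lean`)
could only state as in-file glue while their modules were unbuilt:

* `KernelTower.relLW_exact` — `(R) ⟺ RelLW₀ ∧ ∀ m RelLW_{m+1}` (the vertical normal form: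
  `⇒` = `stub_relLWZero_of_crux` p107727 + `stub_relLWStep_of_crux` p107397,
  `⇐` = `stub_towerReduction` p110214);
* `KernelTower.relLWZero_iff_schanuelOnStageZero` — `RelLW₀ ⟺ SC|_{L₀}`, Schanuel's conjecture for
  `ℚ`-linearly independent tuples of numbers algebraic over `ℚ(π)` (`L₀ = stage 0 = ℚ(2πi)^{ralg}`;
  `⇒` = `KernelTower.schanuelOnStageZero_of_relLWZero`, `⇐` = `stub_relLWZero_of_schanuelOnStageZero`
  p108825);
* `KernelTower.schanuelOnStageSucc_iff` — the LEVEL FILTRATION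
  `SC|_{L_{m+1}} ⟺ SC|_{L_m} ∧ RelLW_{m+1}(m)` (`⇒` = `KernelTower.schanuelOnStage_mono` +
  `stub_relLWStep_of_schanuelOnStageSucc` p110521, `⇐` = `KernelTower.sectorSplit` at `S = L_m`);
* `KernelTower.crux_iff_forall_schanuelOnStage` — `(R) ⟺ ∀ m, SC|_{L_m}` (exhaustion
  `C_EA = ⋃ₘ L_m`, tree `mem_logFreeCore_iff_exists_stage`);
* `KernelTower.crux_iff_schanuelOnStageZero_and_relLWStep` — `(R) ⟺ SC|_{L₀} ∧ ∀ m RelLW_{m+1}(m)`,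
  the glued two-piece split `C₁ ∧ C₂` recommended to the planner (both pieces OPEN; `C₁ ⊇ e ⊥ π`
  by the skeleton's `expOnePi_of_relLWZero`; `C₂` at its first instance `m = 0, u = (e^π)` gives
  `π, e^π, e^{e^π}` algebraically independent, landed calibration `stub_expExpPi_of_relLWStep`).

Here `RelLW₀` := "for `u ⊂ stage 0` `ℚ`-independent modulo `ℚ·2πi`, `(e^{u i})` is algebraically
independent over `stage 0`", `RelLW_{m+1}(m)` := the same one level up (modulo `stage m`, over
`stage (m+1)`), `SC|_{L_m}` := Schanuel's statement for `ℚ`-linearly independent tuples from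
`stage m`; all are written out (no new definitions).  Nothing here is a claim about any layer: every
statement is an equivalence between OPEN statements, certifying that the line's reduction loses
nothing (refuting any layer refutes the crux and hence Schanuel's conjecture,
`RigidCore.crux_of_schanuelConjecture`).  Sources: J. Kirby, *Exponential algebraicity in
exponential fields*, Bull. LMS 42 (2010), arXiv:0810.4285, Prop. 7.2 (sector bookkeeping);
J. Kirby, *Finitely presented exponential fields*, arXiv:0912.4019, Constr. 2.9 (the e/a-chain).
-/

noncomputable section

open IntermediateField
open Summit.Schanuel.Schanuel.Theorems.AclSubsetLogFreeCore.Negative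
  (logFreeCore stage stage_le_succ monotone_stage exp_mem_stage_succ
    mem_logFreeCore_iff_exists_stage stage_le_of_mem logFreeCore_mem_coreFamily)

namespace Summit.Schanuel.Schanuel.Theorems.RigidCore

namespace KernelTower

/-- **The vertical normal form is exact: `(R) ⟺ RelLW₀ ∧ ∀ m, RelLW_{m+1}`.**  `⇒`: the landed
`stub_relLWZero_of_crux` and `stub_relLWStep_of_crux` (hull counts inside the core); `⇐`: the landed
kernel-tower reduction `stub_towerReduction` (sector split level by level + exhaustion of `C_EA` by
the tower).  Both layers are open; the equivalence certifies that the line loses nothing.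
[cite: Kirby2010, Prop. 7.2] -/
theorem relLW_exact :
    Summit.Schanuel.Schanuel.Theses.RigidCore.SchanuelOnLogFreeCore ↔
      ((∀ (r : ℕ) (u : Fin r → ℂ), (∀ i, u i ∈ stage 0) →
          LinearIndependent ℚ
            ((Submodule.span ℚ ({(2 * ↑Real.pi * Complex.I : ℂ)} : Set ℂ)).mkQ ∘ u) →
            AlgebraicIndependent (↥(stage 0)) (fun i => Complex.exp (u i))) ∧
        ∀ (m r : ℕ) (u : Fin r → ℂ), (∀ i, u i ∈ stage (m + 1)) →
          LinearIndependent ℚ ((Submodule.span ℚ (stage m : Set ℂ)).mkQ ∘ u) →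
            AlgebraicIndependent (↥(stage (m + 1))) (fun i => Complex.exp (u i))) :=
  ⟨fun hR => ⟨stub_relLWZero_of_crux hR, stub_relLWStep_of_crux hR⟩,
    fun h => stub_towerReduction h.1 h.2⟩

/-- **`RelLW₀ ⟺ SC|_{L₀}`**: the first open layer of the crux is exactly Schanuel's conjecture
for `ℚ`-linearly independent tuples of numbers algebraic over `ℚ(π)` (`L₀ = stage 0 =
ℚ(2πi)^{ralg}`).  `⇒`: the level-`0` sector split at the kernel line
(`KernelTower.schanuelOnStageZero_of_relLWZero`); `⇐`: `stub_relLWZero_of_schanuelOnStageZero`.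
Its first instance (`x = (1, πi)` on the right, `u = (1)` on the left) is `e ⊥ π`
(`ExpOnePiAlgebraicIndependent`, open). [cite: Kirby2010, Prop. 7.2] -/
theorem relLWZero_iff_schanuelOnStageZero :
    (∀ (r : ℕ) (u : Fin r → ℂ), (∀ i, u i ∈ stage 0) →
      LinearIndependent ℚ ((Submodule.span ℚ ({(2 * ↑Real.pi * Complex.I : ℂ)} : Set ℂ)).mkQ ∘ u) →
        AlgebraicIndependent (↥(stage 0)) (fun i => Complex.exp (u i))) ↔
    ∀ (n : ℕ) (x : Fin n → ℂ), (∀ i, x i ∈ stage 0) → LinearIndependent ℚ x →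
      (n : Cardinal) ≤ Algebra.trdeg ℚ ↥(adjoin ℚ (Set.range x ∪ Set.range (Complex.exp ∘ x))) :=
  ⟨fun h0 => schanuelOnStageZero_of_relLWZero h0, fun hS => stub_relLWZero_of_schanuelOnStageZero hS⟩

/-- **The level filtration: `SC|_{L_{m+1}} ⟺ SC|_{L_m} ∧ RelLW_{m+1}(m)`** for every `m`.
`⇒`: restriction along `stage m ≤ stage (m+1)` (`KernelTower.schanuelOnStage_mono`) and the landed
`stub_relLWStep_of_schanuelOnStageSucc` (hull count parametrised by `SC|_{L_{m+1}}`); `⇐`: the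
sector split `KernelTower.sectorSplit` at the `ℚ`-subspace `L_m ⊆ L_{m+1}` (inside = `SC|_{L_m}`,
the `ℚ`-span of `L_m` being `L_m`; outside = `RelLW_{m+1}(m)`; `e^{L_m} ⊆ L_{m+1}` by
`exp_mem_stage_succ`).  So the crux is filtered by the levels of the kernel tower, each step adding
exactly one relative Lindemann–Weierstrass layer. [cite: Kirby2010, Prop. 7.2] -/
theorem schanuelOnStageSucc_iff (m : ℕ) :
    (∀ (n : ℕ) (x : Fin n → ℂ), (∀ i, x i ∈ stage (m + 1)) → LinearIndependent ℚ x →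
      (n : Cardinal) ≤ Algebra.trdeg ℚ ↥(adjoin ℚ (Set.range x ∪ Set.range (Complex.exp ∘ x)))) ↔
    ((∀ (n : ℕ) (x : Fin n → ℂ), (∀ i, x i ∈ stage m) → LinearIndependent ℚ x →
        (n : Cardinal) ≤ Algebra.trdeg ℚ ↥(adjoin ℚ (Set.range x ∪ Set.range (Complex.exp ∘ x)))) ∧
      ∀ (r : ℕ) (u : Fin r → ℂ), (∀ i, u i ∈ stage (m + 1)) →
        LinearIndependent ℚ ((Submodule.span ℚ (stage m : Set ℂ)).mkQ ∘ u) →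
          AlgebraicIndependent (↥(stage (m + 1))) (fun i => Complex.exp (u i))) := by
  refine ⟨fun hS => ⟨schanuelOnStage_mono (Nat.le_succ m) hS,
    stub_relLWStep_of_schanuelOnStageSucc m hS⟩, fun h => ?_⟩
  intro n x hx hli
  exact sectorSplit (stage m : Set ℂ) (stage (m + 1)) (stage_le_succ m)
    (fun _ ha => exp_mem_stage_succ (mem_of_mem_span (L := stage m) subset_rfl ha))
    (fun k y hy hy' => h.1 k y (fun i => mem_of_mem_span (L := stage m) subset_rfl (hy i)) hy')
    h.2 n x hx hli

/-- **`(R) ⟺ ∀ m, SC|_{L_m}`**: Schanuel's conjecture for the log-free core is the conjunction of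
Schanuel's statements for the levels of the kernel tower (`⇒`: `stage m ≤ C_EA`,
`KernelTower.schanuelOnStage_of_crux`; `⇐`: a tuple from `C_EA = ⋃ₘ stage m`
(`mem_logFreeCore_iff_exists_stage`) sits in one level, the tower being monotone). [folklore] -/
theorem crux_iff_forall_schanuelOnStage :
    Summit.Schanuel.Schanuel.Theses.RigidCore.SchanuelOnLogFreeCore ↔
      ∀ (m n : ℕ) (x : Fin n → ℂ), (∀ i, x i ∈ stage m) → LinearIndependent ℚ x →
        (n : Cardinal) ≤ Algebra.trdeg ℚ ↥(adjoin ℚ (Set.range x ∪ Set.range (Complex.exp ∘ x))) := by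
  refine ⟨fun hR m => schanuelOnStage_of_crux m hR, fun h => ?_⟩
  intro n x hx hli
  have hx' : ∀ i, ∃ m : ℕ, x i ∈ stage m := fun i =>
    mem_logFreeCore_iff_exists_stage.mp (hx i)
  choose lvl hlvl using hx'
  exact h (Finset.univ.sup lvl) n x
    (fun i => monotone_stage (Finset.le_sup (Finset.mem_univ i)) (hlvl i)) hli

/-- **`(R) ⟺ SC|_{L₀} ∧ ∀ m, RelLW_{m+1}(m)`** — the glued two-piece split of the crux (`C₁ ∧ C₂`,
both OPEN: `C₁ = SC|_{L₀} ⊇ e ⊥ π`, `C₂` = heredity up the tower).  `⇒`: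
`KernelTower.schanuelOnStageZero_of_crux` and `stub_relLWStep_of_crux`; `⇐`: `stub_towerReduction`
after `stub_relLWZero_of_schanuelOnStageZero`. [cite: Kirby2010, Prop. 7.2] -/
theorem crux_iff_schanuelOnStageZero_and_relLWStep :
    Summit.Schanuel.Schanuel.Theses.RigidCore.SchanuelOnLogFreeCore ↔
      ((∀ (n : ℕ) (x : Fin n → ℂ), (∀ i, x i ∈ stage 0) → LinearIndependent ℚ x →
          (n : Cardinal) ≤
            Algebra.trdeg ℚ ↥(adjoin ℚ (Set.range x ∪ Set.range (Complex.exp ∘ x)))) ∧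
        ∀ (m r : ℕ) (u : Fin r → ℂ), (∀ i, u i ∈ stage (m + 1)) →
          LinearIndependent ℚ ((Submodule.span ℚ (stage m : Set ℂ)).mkQ ∘ u) →
            AlgebraicIndependent (↥(stage (m + 1))) (fun i => Complex.exp (u i))) :=
  ⟨fun hR => ⟨schanuelOnStageZero_of_crux hR, stub_relLWStep_of_crux hR⟩,
    fun h => stub_towerReduction (stub_relLWZero_of_schanuelOnStageZero h.1) h.2⟩

end KernelTower

/-- **Registered stub `stub_relLWExact` of line `kernel-tower-relative-lw` (signature verbatim) —
the vertical normal form of the crux is EXACT: `(R) ⟺ RelLW₀ ∧ ∀ m RelLW_{m+1}`**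
(= `KernelTower.relLW_exact`; `⇒` p107727 + p107397, `⇐` p110214).  Both layers are OPEN
sub-conjectures of Schanuel's conjecture (RelLW₀ ⊇ `e ⊥ π`); the equivalence closes nothing and
certifies that the line's reduction loses nothing. [cite: Kirby2010, Prop. 7.2] -/
theorem stub_relLWExact :
    Summit.Schanuel.Schanuel.Theses.RigidCore.SchanuelOnLogFreeCore ↔
      ((∀ (r : ℕ) (u : Fin r → ℂ), (∀ i, u i ∈ stage 0) →
          LinearIndependent ℚ
            ((Submodule.span ℚ ({(2 * ↑Real.pi * Complex.I : ℂ)} : Set ℂ)).mkQ ∘ u) →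
            AlgebraicIndependent (↥(stage 0)) (fun i => Complex.exp (u i))) ∧
        ∀ (m r : ℕ) (u : Fin r → ℂ), (∀ i, u i ∈ stage (m + 1)) →
          LinearIndependent ℚ ((Submodule.span ℚ (stage m : Set ℂ)).mkQ ∘ u) →
            AlgebraicIndependent (↥(stage (m + 1))) (fun i => Complex.exp (u i))) :=
  KernelTower.relLW_exact

end Summit.Schanuel.Schanuel.Theorems.RigidCore

end
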